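import Literature.Computability.Complexity.SuccinctCircuitBits
import Literature.Computability.Complexity.CodeFPArithExpr
import Literature.Computability.Complexity.CodeFPStringKit
import Literature.Computability.Complexity.CodeFPBudgets
import HarnessLib

/-!
# Succinct arithmetic circuits, naming layer: gates named by padded tuples of naturals, their
# syntax by fixed arithmetic expressions, and the generic value bound

Companion of `SuccinctCircuitBits.lean` (p1 g9: the structure `SuccCircuit` — gates named by
strings, FP syntax maps `kind/width/cbit/arity/child`, `depth` — its values `val` and bit language).
A consumer who wants to DESCRIBE a concrete exponential-size circuit (val-lit KV20 M1 programme,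
step (P6): the canonical-equation circuit) should write no string code and no machine. This file
provides, once and for all:

* **Tuple names.** A gate is named by an index `n` (unary) and a tuple `t : List ℕ` of fixed
  length, `gcore n t = ⟨1ⁿ, rawE natE t⟩`, ZERO-PADDED to a prescribed length:
  `gname L n t = (gcore n t).takeD L false`. Padding every child to the PARENT's length makes
  `SuccCircuit.length_child` hold for every string with no hypothesis (`length_gchild`), and the
  padding-tolerant total decoder (`gidx`, `gfields`: unary header, then the fields read by
  `fstF ∘ sndF^i`, trailing zeros ignored) inverts `gname` as soon as the core fits
  (`gidx_gname`, `gfields_gname`, `length_gcore_le`).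
* **Environments.** `genv P m g : AEnv` lists the `m` fields of `g`, the index `n`, the length
  `|g|`, the bit sizes of the fields, and consumer-supplied parameters `P n : List ℕ` (dimensions,
  widths, … of the `n`-th circuit); `codeFP_genv` : it is computed in typed polynomial time from
  `CodeFP unE (rawE natE) P`. The syntax maps of a circuit are then `geval P m e g = e.eval (genv P m g)`
  for FIXED arithmetic expressions `e : AExp` (`CodeFPArithExpr.lean`: `+ − × / %`, comparisons,
  conditionals) — `codeFP_geval` — and the children are `gchild P m ch g k = gname |g| n (values of
  the expressions `ch` on the environment with `k` in front)` — `codeFP_gchild`. On canonical names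
  everything is an equation between naturals (`genv_gname`, `gchild_gname`), so a consumer proves
  the `SuccCircuit` axioms and the value equations by arithmetic on tuples only.
* **The generic value bound** (`val_lt_two_pow`): along any child-closed set of gates whose
  constant gates have width `≤ w` and whose sum gates have arity `≤ 2^a` (`a ≥ 1`), `val g <
  2^{(w+a)·2^{depth g}}` — so ONE select width `(w+a)·2^{dmax}` (an `FP` numeral of `dmax + O(log)`
  bits) makes every equality test of the circuit exact (`cval_lt_two_pow`, `mod_eq_of_val_lt`).

HONEST FRAMING (val-lit, KV20 M1 programme (P6), RULING (120)): generic plumbing; proves nothing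
about `kumarVolk2020_cor_1_3` by itself; `VP ≠ VNP` is NOT proved and nothing here bears on it.

## References

* P. Koiran, S. Perifel, *VPSPACE and a transfer theorem over the reals*, Comput. Complexity 18
  (2009) 551–575, §3.2 (Uniform `VPAR⁰`: gates of a polynomial-depth circuit described by
  polynomial-time functions of their names) [KoiranPerifel2009VPSPACE].
* S. Arora, B. Barak, *Computational Complexity: A Modern Approach*, CUP 2009, §0.1 (codes of
  tuples), §1.3 (closure of polynomial time), §6.8 Def. 6.30 (succinct representations of
  exponential objects by circuits on binary indices) [AroraBarak2009].
-/

noncomputable section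

namespace Literature.Computability.Complexity

open _root_.Computability CodeFP Brick Finset

namespace SuccCircuit

/-! ### Tuple names and their padding-tolerant decoding -/

/-- The core of a tuple name: `⟨1ⁿ, rawE natE t⟩`. [cite: AroraBarak2009, §0.1 (codes of tuples)] -/
def gcore (n : ℕ) (t : List ℕ) : List Bool := boolPair (unE n) (rawE natE t)

/-- **The name of the gate `t` of the `n`-th circuit, padded to length `L`**:
`(gcore n t).takeD L false`. [cite: KoiranPerifel2009VPSPACE, §3.2 (gates named by strings); AroraBarak2009, §0.1] -/
def gname (L n : ℕ) (t : List ℕ) : List Bool := (gcore n t).takeD L false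

/-- The index `n` read off a name: the length of its first field. [cite: AroraBarak2009, §0.1] -/
def gidx (g : List Bool) : ℕ := (fstF g).length

/-- The first `m` fields of a body, read by `fstF ∘ sndF^i` (total; trailing padding is never
reached). [cite: AroraBarak2009, §0.1] -/
def gfields : ℕ → List Bool → List ℕ
  | 0, _ => []
  | m + 1, w => bitsToNat (fstF w) :: gfields m (sndF w)

/-- A padded name has exactly the prescribed length. [cite: AroraBarak2009, §0.1 (codes of tuples)] -/
@[simp] theorem length_gname (L n : ℕ) (t : List ℕ) : (gname L n t).length = L := by
  simp [gname]

/-- `gfields m` returns `m` numbers. [cite: AroraBarak2009, §0.1 (codes of tuples)] -/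
@[simp] theorem length_gfields : ∀ (m : ℕ) (w : List Bool), (gfields m w).length = m
  | 0, _ => rfl
  | m + 1, w => by simp [gfields, length_gfields m]

/-- Appending after a pair appends to its second component (also `Cryptography.boolPair_append`,
not imported here). [folklore] -/
private theorem boolPair_append (a b j : List Bool) : boolPair a b ++ j = boolPair a (b ++ j) := by
  simp [boolPair, List.append_assoc]

/-- Reading `|t|` fields from `rawE natE t` followed by any padding gives back `t`. [cite: AroraBarak2009, §0.1] -/
theorem gfields_rawE_append : ∀ (t : List ℕ) (pad : List Bool), gfields t.length (rawE natE t ++ pad) = t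
  | [], _ => rfl
  | a :: t, pad => by
    rw [List.length_cons, gfields, rawE_cons, boolPair_append, fstF_boolPair, sndF_boolPair,
      gfields_rawE_append t pad, show natE a = encodeNat a from rfl, bitsToNat_encodeNat]

/-- If the core fits, the padded name is the core followed by zeros. [cite: AroraBarak2009, §0.1 (codes of tuples)] -/
theorem gname_eq_append {L n : ℕ} {t : List ℕ} (h : (gcore n t).length ≤ L) :
    gname L n t = gcore n t ++ List.replicate (L - (gcore n t).length) false := by
  obtain ⟨e, he⟩ : ∃ e, L = (gcore n t).length + e := ⟨L - (gcore n t).length, by omega⟩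
  rw [gname, BitFormat.takeD_eq_take_append_replicate, he, List.take_length_add_append, List.take_replicate,
    Nat.add_sub_cancel_left, min_eq_left (Nat.le_add_left _ _)]

/-- **Decoding the index**: `gidx (gname L n t) = n` when the core fits. [cite: AroraBarak2009, §0.1] -/
theorem gidx_gname {L n : ℕ} {t : List ℕ} (h : (gcore n t).length ≤ L) : gidx (gname L n t) = n := by
  rw [gname_eq_append h, gidx, gcore, boolPair_append, fstF_boolPair, length_unE]

/-- **Decoding the fields**: `gfields |t| (sndF (gname L n t)) = t` when the core fits. [cite: AroraBarak2009, §0.1] -/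
theorem gfields_gname {L n : ℕ} {t : List ℕ} (h : (gcore n t).length ≤ L) :
    gfields t.length (sndF (gname L n t)) = t := by
  rw [gname_eq_append h, gcore, boolPair_append, sndF_boolPair, gfields_rawE_append]

/-- The length of a raw list of numerals below `2^B`. [cite: AroraBarak2009, §0.1 (codes of tuples)] -/
theorem length_rawE_natE_le {t : List ℕ} {B : ℕ} (ht : ∀ a ∈ t, a < 2 ^ B) :
    (rawE natE t).length ≤ t.length * (2 * B + 2) := by
  induction t with
  | nil => simp
  | cons a t ih =>
    rw [rawE_cons, length_boolPair, List.length_cons]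
    have ha : (natE a).length ≤ B := by rw [length_natE]; exact Nat.size_le.2 (ht a (by simp))
    have := ih fun b hb => ht b (by simp [hb])
    nlinarith

/-- **The core fits in `2n + 2 + |t|·(2B + 2)` bits** when the fields are below `2^B`. [cite: AroraBarak2009, §0.1] -/
theorem length_gcore_le {n : ℕ} {t : List ℕ} {B : ℕ} (ht : ∀ a ∈ t, a < 2 ^ B) :
    (gcore n t).length ≤ 2 * n + 2 + t.length * (2 * B + 2) := by
  rw [gcore, length_boolPair, length_unE]
  have := length_rawE_natE_le ht
  omega

/-! ### Typed polynomial time: names and decoding -/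

/-- **Names are written in polynomial time** from `⟨1ᴸ, 1ⁿ, t⟩`. [cite: AroraBarak2009, §1.3] -/
theorem codeFP_gname : CodeFP (pairE unE (pairE unE (rawE natE))) strE (fun p => gname p.1 p.2.1 p.2.2) :=
  (CodeFP.takeD.comp ((fst _ _).pair ((snd unE (pairE unE (rawE natE))).recodeOut (eγ := strE) fun _ => rfl))).congr
    fun _ => rfl

/-- `fstF` as a typed map on strings (also `QuantumAdvantage.fstF_code`, not imported here). [folklore] -/
private theorem codeFP_fstF : CodeFP strE strE fstF := of_fn fstF fstF_mem_FP fun _ => rfl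

/-- `sndF` as a typed map on strings (also `SumcheckIP.sndC`, not imported here). [folklore] -/
private theorem codeFP_sndF : CodeFP strE strE sndF := of_fn sndF sndF_mem_FP fun _ => rfl

/-- The index is read in polynomial time (in unary). [cite: AroraBarak2009, §1.3] -/
theorem codeFP_gidx : CodeFP strE unE gidx := (strLength.comp codeFP_fstF).congr fun _ => rfl

/-- The fields are read in polynomial time. [cite: AroraBarak2009, §1.3] -/
theorem codeFP_gfields : ∀ m : ℕ, CodeFP strE (rawE natE) (gfields m)
  | 0 => const _ []
  | m + 1 => ((rawCons natE).comp ((strVal.comp codeFP_fstF).pair ((codeFP_gfields m).comp codeFP_sndF))).congr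
      fun _ => rfl

/-! ### Environments and syntax maps given by fixed arithmetic expressions -/

/-- **The environment of a name** for a parameter map `P` and `m` fields: the scalars are the `m`
fields, then the index `n`, then the length of the name, then the bit sizes of the `m` fields, then
the parameters `P n`; no tables. [cite: KoiranPerifel2009VPSPACE, §3.2 (Uniform VPAR⁰)] -/
def genv (P : ℕ → List ℕ) (m : ℕ) (g : List Bool) : AEnv :=
  (gfields m (sndF g) ++ (gidx g :: g.length :: ((gfields m (sndF g)).map Nat.size ++ P (gidx g))), [])

/-- The abstract environment of a tuple: what `genv` returns on a canonical name (`genv_gname`) and,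
more generally, on any string (`genv_eq`). [cite: KoiranPerifel2009VPSPACE, §3.2] -/
def aenv (P : ℕ → List ℕ) (n len : ℕ) (t : List ℕ) : AEnv :=
  (t ++ (n :: len :: (t.map Nat.size ++ P n)), [])

/-- Every string's environment is the abstract environment of its decoded data. [cite: KoiranPerifel2009VPSPACE, §3.2 (Uniform VPAR⁰)] -/
theorem genv_eq (P : ℕ → List ℕ) (m : ℕ) (g : List Bool) :
    genv P m g = aenv P (gidx g) g.length (gfields m (sndF g)) := rfl

/-- **On a canonical name the environment is the tuple's.** [cite: KoiranPerifel2009VPSPACE, §3.2] -/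
theorem genv_gname (P : ℕ → List ℕ) {L n : ℕ} {t : List ℕ} (h : (gcore n t).length ≤ L) :
    genv P t.length (gname L n t) = aenv P n L t := by
  rw [genv_eq, gidx_gname h, gfields_gname h, length_gname]

/-- `genv_gname` with the number of fields named. [cite: KoiranPerifel2009VPSPACE, §3.2] -/
theorem genv_gname' (P : ℕ → List ℕ) {L n m : ℕ} {t : List ℕ} (hm : t.length = m) (h : (gcore n t).length ≤ L) :
    genv P m (gname L n t) = aenv P n L t := by
  subst hm; exact genv_gname P h

/-- Bit size as a typed map. [folklore] -/
private theorem codeFP_size : CodeFP natE natE Nat.size :=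
  (strNatLength.comp strOfNat).congr fun a => length_natE a

/-- **The environment is computed in polynomial time** from a name, given the parameters in
polynomial time from `1ⁿ`. [cite: AroraBarak2009, §1.3] -/
theorem codeFP_genv {P : ℕ → List ℕ} (hP : CodeFP unE (rawE natE) P) (m : ℕ) :
    CodeFP strE aenvE (genv P m) := by
  have hf : CodeFP strE (rawE natE) (fun g => gfields m (sndF g)) := (codeFP_gfields m).comp codeFP_sndF
  have hn : CodeFP strE natE gidx := natOfUn.comp codeFP_gidx
  have hs : CodeFP strE (rawE natE) (fun g => (gfields m (sndF g)).map Nat.size) := (map₀ codeFP_size).comp hf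
  have hp : CodeFP strE (rawE natE) (fun g => P (gidx g)) := hP.comp codeFP_gidx
  exact codeFP_mkEnv ((rawAppend natE).comp (hf.pair (codeFP_consNat hn (codeFP_consNat strNatLength
    ((rawAppend natE).comp (hs.pair hp)))))) (const _ [])

/-- **A syntax map given by a fixed expression**: `geval P m e g = e.eval (genv P m g)`.
[cite: KoiranPerifel2009VPSPACE, §3.2 (the kind / arity / … of a gate as a function of its name)] -/
def geval (P : ℕ → List ℕ) (m : ℕ) (e : AExp) (g : List Bool) : ℕ := e.eval (genv P m g)

/-- Fixed expressions are evaluated on names in polynomial time. [cite: AroraBarak2009, §1.3] -/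
theorem codeFP_geval {P : ℕ → List ℕ} (hP : CodeFP unE (rawE natE) P) (m : ℕ) (e : AExp) :
    CodeFP strE natE (geval P m e) :=
  codeFP_eval' (codeFP_genv hP m) e

/-- On a canonical name. [cite: KoiranPerifel2009VPSPACE, §3.2] -/
theorem geval_gname (P : ℕ → List ℕ) {L n : ℕ} {t : List ℕ} (h : (gcore n t).length ≤ L) (e : AExp) :
    geval P t.length e (gname L n t) = e.eval (aenv P n L t) := by
  rw [geval, genv_gname P h]

/-- `geval_gname` with the number of fields named. [cite: KoiranPerifel2009VPSPACE, §3.2] -/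
theorem geval_gname' (P : ℕ → List ℕ) {L n m : ℕ} {t : List ℕ} (hm : t.length = m) (h : (gcore n t).length ≤ L)
    (e : AExp) : geval P m e (gname L n t) = e.eval (aenv P n L t) := by
  subst hm; exact geval_gname P h e

/-- The environment with a child index in front (scalar `0`; the name's scalars shift by one). [folklore] -/
def genvK (P : ℕ → List ℕ) (m : ℕ) (g : List Bool) (k : ℕ) : AEnv := (k :: (genv P m g).1, [])

/-- The abstract environment with a child index in front. [folklore] -/
def aenvK (P : ℕ → List ℕ) (n len : ℕ) (t : List ℕ) (k : ℕ) : AEnv := (k :: (aenv P n len t).1, [])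

/-- On a canonical name. [cite: KoiranPerifel2009VPSPACE, §3.2 (Uniform VPAR⁰)] -/
theorem genvK_gname (P : ℕ → List ℕ) {L n : ℕ} {t : List ℕ} (h : (gcore n t).length ≤ L) (k : ℕ) :
    genvK P t.length (gname L n t) k = aenvK P n L t k := by
  rw [genvK, genv_gname P h]; rfl

/-- **The children given by fixed expressions**: the child `k` of `g` is the tuple of the values of
`ch` on the environment of `g` with `k` in front, named with the SAME index and padded to the
PARENT's length. [cite: KoiranPerifel2009VPSPACE, §3.2 (children of a gate as a function of the name)] -/
def gchild (P : ℕ → List ℕ) (m : ℕ) (ch : List AExp) (g : List Bool) (k : ℕ) : List Bool :=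
  gname g.length (gidx g) (ch.map (AExp.eval (genvK P m g k)))

/-- **Children never lengthen** — for EVERY string, by construction. [cite: KoiranPerifel2009VPSPACE, §3.2 (names padded to a common length)] -/
@[simp] theorem length_gchild (P : ℕ → List ℕ) (m : ℕ) (ch : List AExp) (g : List Bool) (k : ℕ) :
    (gchild P m ch g k).length = g.length :=
  length_gname _ _ _

/-- On a canonical name the child is the canonical name of the child tuple. [cite: KoiranPerifel2009VPSPACE, §3.2] -/
theorem gchild_gname (P : ℕ → List ℕ) {L n : ℕ} {t : List ℕ} (h : (gcore n t).length ≤ L)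
    (ch : List AExp) (k : ℕ) :
    gchild P t.length ch (gname L n t) k = gname L n (ch.map (AExp.eval (aenvK P n L t k))) := by
  rw [gchild, length_gname, gidx_gname h, genvK_gname P h]

/-- `gchild_gname` with the number of fields named. [cite: KoiranPerifel2009VPSPACE, §3.2] -/
theorem gchild_gname' (P : ℕ → List ℕ) {L n m : ℕ} {t : List ℕ} (hm : t.length = m) (h : (gcore n t).length ≤ L)
    (ch : List AExp) (k : ℕ) :
    gchild P m ch (gname L n t) k = gname L n (ch.map (AExp.eval (aenvK P n L t k))) := by
  subst hm; exact gchild_gname P h ch k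

/-- On any string, the child is the name (same index, parent's length) of the tuple computed on the
decoded data — the form in which the `SuccCircuit` axioms are checked for ALL strings. [cite: KoiranPerifel2009VPSPACE, §3.2 (Uniform VPAR⁰)] -/
theorem gchild_eq (P : ℕ → List ℕ) (m : ℕ) (ch : List AExp) (g : List Bool) (k : ℕ) :
    gchild P m ch g k =
      gname g.length (gidx g) (ch.map (AExp.eval (aenvK P (gidx g) g.length (gfields m (sndF g)) k))) := rfl

/-- **The children are computed in polynomial time** from `⟨name, index⟩`. [cite: AroraBarak2009, §1.3] -/
theorem codeFP_gchild {P : ℕ → List ℕ} (hP : CodeFP unE (rawE natE) P) (m : ℕ) (ch : List AExp) :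
    CodeFP (pairE strE natE) strE (fun p => gchild P m ch p.1 p.2) := by
  -- the extended environment
  have hK : CodeFP (pairE strE natE) aenvE (fun p => genvK P m p.1 p.2) :=
    (codeFP_consNat (snd strE natE) ((codeFP_genv hP m).comp (fst strE natE)).fst').pair (const _ [])
  -- the child's core as the code of a typed pair, then padded to the parent's length
  have hcore : CodeFP (pairE strE natE) (pairE unE (rawE natE))
      (fun p => (gidx p.1, ch.map (AExp.eval (genvK P m p.1 p.2)))) :=
    (codeFP_gidx.comp (fst strE natE)).pair (codeFP_evalList' hK ch)
  exact (CodeFP.takeD.comp ((strLength.comp (fst strE natE)).pair (hcore.recodeOut (eγ := strE) fun _ => rfl))).congr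
    fun _ => rfl

/-! ### The generic value bound -/

variable (K : SuccCircuit)

/-- `∑_{i<W} 2^i < 2^W`. [folklore] -/
private theorem sum_two_pow_lt (W : ℕ) : ∑ i ∈ range W, 2 ^ i < 2 ^ W := by
  induction W with
  | zero => simp
  | succ W ih => rw [sum_range_succ, pow_succ]; omega

/-- A constant gate's value is below `2^{width}`. [cite: KoiranPerifel2009VPSPACE, §3.2, Prop. 1 (input gates)] -/
theorem cval_lt_two_pow (g : List Bool) : K.cval g < 2 ^ K.width g := by
  unfold cval
  calc ∑ i ∈ range (K.width g), (if K.cbit g i then 2 ^ i else 0)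
      ≤ ∑ i ∈ range (K.width g), 2 ^ i := sum_le_sum fun i _ => by split_ifs <;> simp
    _ < 2 ^ K.width g := sum_two_pow_lt _

/-- **The generic value bound.** Let `Φ` be a set of gates closed under taking children, whose
constant gates have width `≤ w` and whose sum gates have arity `≤ 2^a`. Then every gate
`g ∈ Φ` has `val g < 2^{(w + a)·2^{depth g}}`. (Product gates square, sum gates add `a` bits, and
`(w+a)2^{d-1} + a ≤ (w+a)2^d`.) [cite: KoiranPerifel2009VPSPACE, §3.2, Prop. 1 (proof: "the value of a gate … has at most exponentially many bits")] -/
theorem val_lt_two_pow (Φ : List Bool → Prop) {w a : ℕ}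
    (hcl : ∀ g k, Φ g → k < gateFanIn (K.kind g) (K.arity g) → Φ (K.child g k))
    (hw : ∀ g, Φ g → K.kind g ≠ 1 → K.kind g ≠ 2 → K.kind g ≠ 3 → K.width g ≤ w)
    (har : ∀ g, Φ g → K.kind g = 1 → K.arity g ≤ 2 ^ a) :
    ∀ g, Φ g → K.val g < 2 ^ ((w + a) * 2 ^ K.depth g) := by
  -- strong induction on the depth
  suffices h : ∀ d g, K.depth g = d → Φ g → K.val g < 2 ^ ((w + a) * 2 ^ d) from
    fun g hg => h _ g rfl hg
  intro d
  induction d using Nat.strong_induction_on with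
  | _ d ih =>
    intro g hd hg
    -- a child `c` of `g` satisfies the bound with exponent `(w+a)·2^(d-1)`
    have hch : ∀ k, k < gateFanIn (K.kind g) (K.arity g) →
        K.val (K.child g k) < 2 ^ ((w + a) * 2 ^ (d - 1)) := fun k hk => by
      have hlt : K.depth (K.child g k) < d := hd ▸ K.depth_child g k hk
      exact (ih _ hlt _ rfl (hcl g k hg hk)).trans_le
        (Nat.pow_le_pow_right (by norm_num) (Nat.mul_le_mul_left _
          (Nat.pow_le_pow_right (by norm_num) (by omega))))
    have hd1 : ∀ k, k < gateFanIn (K.kind g) (K.arity g) → 1 ≤ d := fun k hk => by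
      have := K.depth_child g k hk; omega
    -- `(w+a)·2^(d-1)·2 = (w+a)·2^d` for `d ≥ 1`
    have hsq : 1 ≤ d → (w + a) * 2 ^ (d - 1) + (w + a) * 2 ^ (d - 1) = (w + a) * 2 ^ d := fun h1 => by
      obtain ⟨e, rfl⟩ : ∃ e, d = e + 1 := ⟨d - 1, by omega⟩
      rw [Nat.add_sub_cancel, pow_succ]; ring
    by_cases h1 : K.kind g = 1
    · -- sum gate: at most `2^a` summands, each `< 2^((w+a)2^(d-1))`
      rw [K.val_sum h1]
      have hA := har g hg h1
      have hfan : ∀ k, k < K.arity g → k < gateFanIn (K.kind g) (K.arity g) := fun k hk => by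
        simp [gateFanIn, h1, hk]
      rcases Nat.eq_zero_or_pos (K.arity g) with h0 | hpos
      · rw [h0, sum_range_zero]; positivity
      have hd' : 1 ≤ d := hd1 0 (hfan 0 hpos)
      calc ∑ k ∈ range (K.arity g), K.val (K.child g k)
          < ∑ _k ∈ range (K.arity g), 2 ^ ((w + a) * 2 ^ (d - 1)) :=
            sum_lt_sum (fun k hk => (hch k (hfan k (mem_range.1 hk))).le)
              ⟨0, mem_range.2 hpos, hch 0 (hfan 0 hpos)⟩
        _ = K.arity g * 2 ^ ((w + a) * 2 ^ (d - 1)) := by rw [sum_const, card_range, smul_eq_mul]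
        _ ≤ 2 ^ a * 2 ^ ((w + a) * 2 ^ (d - 1)) := Nat.mul_le_mul_right _ hA
        _ = 2 ^ (a + (w + a) * 2 ^ (d - 1)) := by rw [pow_add]
        _ ≤ 2 ^ ((w + a) * 2 ^ d) := Nat.pow_le_pow_right (by norm_num) (by
            have : a ≤ (w + a) * 2 ^ (d - 1) :=
              (Nat.le_add_left a w).trans (Nat.le_mul_of_pos_right _ (by positivity))
            have := hsq hd'; omega)
    · by_cases h2 : K.kind g = 2
      · -- product gate
        rw [K.val_mul h2]
        have hf0 : 0 < gateFanIn (K.kind g) (K.arity g) := by simp [gateFanIn, h2]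
        have hf1 : 1 < gateFanIn (K.kind g) (K.arity g) := by simp [gateFanIn, h2]
        have hd' : 1 ≤ d := hd1 0 hf0
        calc K.val (K.child g 0) * K.val (K.child g 1)
            < 2 ^ ((w + a) * 2 ^ (d - 1)) * 2 ^ ((w + a) * 2 ^ (d - 1)) :=
              Nat.mul_lt_mul'' (hch 0 hf0) (hch 1 hf1)
          _ = 2 ^ ((w + a) * 2 ^ d) := by rw [← pow_add, hsq hd']
      · by_cases h3 : K.kind g = 3
        · -- select gate
          rw [K.val_mux h3]
          have hf2 : 2 < gateFanIn (K.kind g) (K.arity g) := by simp [gateFanIn, h3]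
          have hf3 : 3 < gateFanIn (K.kind g) (K.arity g) := by simp [gateFanIn, h3]
          have hd' : 1 ≤ d := hd1 2 hf2
          have hmono : 2 ^ ((w + a) * 2 ^ (d - 1)) ≤ 2 ^ ((w + a) * 2 ^ d) :=
            Nat.pow_le_pow_right (by norm_num) (by have := hsq hd'; omega)
          split_ifs
          · exact (hch 2 hf2).trans_le hmono
          · exact (hch 3 hf3).trans_le hmono
        · -- constant gate
          rw [K.val_const h1 h2 h3]
          exact (K.cval_lt_two_pow g).trans_le (Nat.pow_le_pow_right (by norm_num)
            ((hw g hg h1 h2 h3).trans ((Nat.le_add_right w a).trans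
              (Nat.le_mul_of_pos_right _ (by positivity)))))

/-- Below the select width, reduction modulo `2^W` is the identity: the select gate then tests
genuine equality. [cite: KoiranPerifel2009VPSPACE, §3.2] -/
theorem mod_eq_of_val_lt {g : List Bool} {W : ℕ} (h : K.val g < 2 ^ W) : K.val g % 2 ^ W = K.val g :=
  Nat.mod_eq_of_lt h

end SuccCircuit

end Literature.Computability.Complexity

end
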